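import Literature.Analysis.FluidPDE.PeriodicLerayProfileGradient
import HarnessLib

/-!
# [BT1] Lemma 2.5, discharge I: the cut-off `ξ_R`, the density `∇ξ_R · U₀`, regularity,
# periodicity and solenoidality of the revised profile `W = ξ_R U₀ + w`

Analysis/FluidPDE proof file (theorems only), first part of the discharge of the named fact
`Literature.Analysis.FluidPDE.bradshawTsai2017_lemma_2_5` (`PeriodicLerayExistence.lean`;
Bradshaw–Tsai, Ann. Henri Poincaré 18 (2017) = arXiv:1510.07504 [BT1], Lemma 2.5). For the
objects of that file — `cutoffScaled R = ξ_R = Z(·/R)`, the divergence correction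
`profileCorrector R U₀ s y = w(y,s) = −∫ (∇ξ_R·U₀)(z,s) ∇Γ(y − z) dz` and
`revisedProfile R U₀ = W = ξ_R U₀ + w` — this file proves:

* `ξ_R`: `|∇ξ_R| ≤ C_Z/R` ("`|∇ᵏξ_R| ≲ R⁻ᵏ`"), `∇ξ_R = 0` for `|z| ≤ R` and for `|z| ≥ 2R`;
* the density `G_R(s,z) = ∇ξ_R(z)·U₀(z,s)` is jointly `C¹` when `U₀` is, vanishes for
  `|z| > 2R`, and `w(s,·) = −(G_R(s,·) ⋆ ∇Γ)` (`profileCorrector_eq_neg_convolution`);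
* "`W` is locally continuously differentiable in `y` and `s`"
  (`contDiff_uncurry_revisedProfile`, from `NewtonGradPotential.contDiff_convolution_gradient_newtonKernel_param`),
  "`T`-periodic" (`revisedProfile_add_period`), and "divergence free"
  (`isDivFree_revisedProfile`: "`div W = ∇ξ·U₀ + div w = 0`", by
  `NewtonGradPotential.divergence_convolution_gradient_newtonKernel`);
* a sup bound for continuous `T`-periodic fields on `ℝ × K`, `K` compact
  (`exists_forall_norm_le_of_periodic`), used for "`U₀` and `∇U₀` belong to `L^∞_loc(ℝ³ × ℝ)`".

Reused from `PeriodicLerayProfileGradient.lean` (the discharge of the gradient bound of the same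
proof): `contDiff_gradient_cutoffScaled`, `contDiff_cutoffGradDensity`,
`cutoffGradDensity_eq_zero`, `hasCompactSupport_cutoffGradDensity`, `gradient_cutoffScaled_eq_zero`
(the case `|z| > 2R`; here also `|z| ≤ R` and `|z| = 2R` are needed, `∇ξ_R` being supported in
the open shell).

## References

* Z. Bradshaw, T.-P. Tsai, Ann. Henri Poincaré 18 (2017) = arXiv:1510.07504, §2, the cut-off `Z`,
  `ξ_R`, Lemma 2.5 and its proof [BradshawTsai2017AHP].
-/

noncomputable section

open MeasureTheory Set Function Filter Topology TopologicalSpace Metric InnerProductSpace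
open scoped NNReal ENNReal RealInnerProductSpace Convolution

namespace Literature.Analysis.FluidPDE

namespace BradshawTsai2017

open NewtonGradPotential

/-! ### Continuous periodic fields are bounded on `ℝ × K` -/

/-- **Sup bound for continuous periodic fields.** A continuous `F : ℝ × X → Y`, `T`-periodic in
the first variable with `T > 0`, is bounded on `ℝ × K` for every compact `K` (it suffices to
bound it on the compact `[0,T] × K`). [folklore] -/
theorem exists_forall_norm_le_of_periodic {X Y : Type*} [TopologicalSpace X]
    [NormedAddCommGroup Y] {F : ℝ × X → Y} (hF : Continuous F) {T : ℝ} (hT : 0 < T)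
    (hper : ∀ s x, F (s + T, x) = F (s, x)) {K : Set X} (hK : IsCompact K) :
    ∃ M : ℝ, 0 ≤ M ∧ ∀ s, ∀ x ∈ K, ‖F (s, x)‖ ≤ M := by
  obtain ⟨M, hM⟩ := (isCompact_Icc.prod hK).exists_bound_of_continuousOn
    (s := Icc (0 : ℝ) T ×ˢ K) hF.continuousOn
  refine ⟨max M 0, le_max_right _ _, fun s x hx => ?_⟩
  have hp : Function.Periodic (fun s => fun x => F (s, x)) T := fun s => funext fun x => hper s x
  obtain ⟨s', hs', hss'⟩ := hp.exists_mem_Ico₀ hT s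
  have e : F (s, x) = F (s', x) := congrFun hss' x
  rw [e]
  exact (hM (s', x) ⟨Ico_subset_Icc_self hs', hx⟩).trans (le_max_left _ _)

/-! ### The cut-off `ξ_R`: gradient bound and support of the gradient -/

/-- `DZ` is bounded: `‖DZ(z)‖ ≤ C_Z` for all `z` (`Z = 1 −` a bump, so `DZ` is continuous with
compact support). [cite: BradshawTsai2017AHP, §2 before Lemma 2.5] -/
theorem exists_norm_fderiv_cutoffZ_le : ∃ C : ℝ, 0 ≤ C ∧ ∀ z, ‖fderiv ℝ cutoffZ z‖ ≤ C := by
  have h1 : fderiv ℝ cutoffZ = fun z => -fderiv ℝ (fun y => (cutoffBump : ContDiffBump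
      (0 : EuclideanSpace ℝ (Fin 3))) y) z := by
    funext z
    have : cutoffZ = fun y => (1 : ℝ) - cutoffBump y := rfl
    rw [this, fderiv_const_sub]
  have hc : Continuous (fderiv ℝ cutoffZ) := (contDiff_cutoffZ (n := 1)).continuous_fderiv one_ne_zero
  have hsupp : HasCompactSupport (fderiv ℝ cutoffZ) := by
    rw [h1]
    exact (cutoffBump.hasCompactSupport.fderiv (𝕜 := ℝ)).neg
  obtain ⟨C, hC⟩ := hc.bounded_above_of_compact_support hsupp
  exact ⟨max C 0, le_max_right _ _, fun z => (hC z).trans (le_max_left _ _)⟩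

/-- `D(ξ_R)(z) = R⁻¹ DZ(z/R)` (chain rule for the dilation). [cite: BradshawTsai2017AHP, §2 before Lemma 2.5] -/
theorem fderiv_cutoffScaled {R : ℝ} (hR : R ≠ 0) (z : EuclideanSpace ℝ (Fin 3)) :
    fderiv ℝ (cutoffScaled R) z = R⁻¹ • fderiv ℝ cutoffZ (R⁻¹ • z) := by
  have e : cutoffScaled R = fun y => (1 : ℝ) • cutoffZ (R⁻¹ • y) := by
    funext y; rw [one_smul]; rfl
  rw [e, fderiv_const_smul_comp_smul cutoffZ 1 (inv_ne_zero hR), one_mul]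

/-- **"`|∇ξ_R| ≲ R⁻¹`"**: there is `C_Z ≥ 0` with `‖∇ξ_R(z)‖ ≤ C_Z/R` for all `R > 0` and all
`z`. [cite: BradshawTsai2017AHP, §2 before Lemma 2.5] -/
theorem exists_norm_gradient_cutoffScaled_le :
    ∃ C : ℝ, 0 ≤ C ∧ ∀ {R : ℝ}, 0 < R → ∀ z, ‖gradient (cutoffScaled R) z‖ ≤ C / R := by
  obtain ⟨C, hC0, hC⟩ := exists_norm_fderiv_cutoffZ_le
  refine ⟨C, hC0, fun {R} hR z => ?_⟩
  rw [gradient, LinearIsometryEquiv.norm_map, fderiv_cutoffScaled hR.ne', norm_smul, norm_inv,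
    Real.norm_of_nonneg hR.le, div_eq_inv_mul]
  exact mul_le_mul_of_nonneg_left (hC _) (by positivity)

/-- `Dξ_R` is continuous. [cite: BradshawTsai2017AHP, §2 before Lemma 2.5] -/
theorem continuous_fderiv_cutoffScaled (R : ℝ) : Continuous (fderiv ℝ (cutoffScaled R)) :=
  (contDiff_cutoffScaled R (n := 1)).continuous_fderiv one_ne_zero

/-- `Dξ_R(z) = 0` for `|z| ≤ R` (`ξ_R = 0` on the open ball, and `Dξ_R` is continuous). [cite: BradshawTsai2017AHP, §2 before Lemma 2.5] -/
theorem fderiv_cutoffScaled_eq_zero_of_le {R : ℝ} (hR : 0 < R) {z : EuclideanSpace ℝ (Fin 3)}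
    (hz : ‖z‖ ≤ R) : fderiv ℝ (cutoffScaled R) z = 0 := by
  -- on the open ball the function is locally zero
  have hopen : ∀ w ∈ ball (0 : EuclideanSpace ℝ (Fin 3)) R, fderiv ℝ (cutoffScaled R) w = 0 := by
    intro w hw
    have hev : cutoffScaled R =ᶠ[𝓝 w] fun _ => (0 : ℝ) := by
      filter_upwards [isOpen_ball.mem_nhds hw] with u hu
      exact cutoffScaled_eq_zero hR (le_of_lt (mem_ball_zero_iff.1 hu))
    rw [hev.fderiv_eq, fderiv_const_apply]
  -- pass to the closure
  have hcl : closedBall (0 : EuclideanSpace ℝ (Fin 3)) R ⊆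
      (fderiv ℝ (cutoffScaled R)) ⁻¹' {0} := by
    rw [← closure_ball (0 : EuclideanSpace ℝ (Fin 3)) hR.ne']
    exact closure_minimal (fun w hw => hopen w hw)
      (isClosed_singleton.preimage (continuous_fderiv_cutoffScaled R))
  exact hcl (mem_closedBall_zero_iff.2 hz)

/-- `Dξ_R(z) = 0` for `|z| ≥ 2R` (`ξ_R = 1` off the closed ball of radius `2R`, and `Dξ_R` is
continuous). [cite: BradshawTsai2017AHP, §2 before Lemma 2.5] -/
theorem fderiv_cutoffScaled_eq_zero_of_ge {R : ℝ} (hR : 0 < R) {z : EuclideanSpace ℝ (Fin 3)}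
    (hz : 2 * R ≤ ‖z‖) : fderiv ℝ (cutoffScaled R) z = 0 := by
  have hopen : ∀ w ∈ (closedBall (0 : EuclideanSpace ℝ (Fin 3)) (2 * R))ᶜ,
      fderiv ℝ (cutoffScaled R) w = 0 := by
    intro w hw
    have hev : cutoffScaled R =ᶠ[𝓝 w] fun _ => (1 : ℝ) := by
      filter_upwards [isClosed_closedBall.isOpen_compl.mem_nhds hw] with u hu
      rw [mem_compl_iff, mem_closedBall_zero_iff, not_le] at hu
      exact cutoffScaled_eq_one hR hu.le
    rw [hev.fderiv_eq, fderiv_const_apply]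
  have hcl : (ball (0 : EuclideanSpace ℝ (Fin 3)) (2 * R))ᶜ ⊆
      (fderiv ℝ (cutoffScaled R)) ⁻¹' {0} := by
    have e : closure ((closedBall (0 : EuclideanSpace ℝ (Fin 3)) (2 * R))ᶜ) =
        (ball (0 : EuclideanSpace ℝ (Fin 3)) (2 * R))ᶜ := by
      rw [closure_compl, interior_closedBall _ (by positivity : (2 * R : ℝ) ≠ 0)]
    rw [← e]
    exact closure_minimal (fun w hw => hopen w hw)
      (isClosed_singleton.preimage (continuous_fderiv_cutoffScaled R))
  exact hcl (by rw [mem_compl_iff, mem_ball_zero_iff, not_lt]; exact hz)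

/-- `∇ξ_R(z) = 0` unless `R < |z| < 2R`. [cite: BradshawTsai2017AHP, §2 before Lemma 2.5] -/
theorem gradient_cutoffScaled_eq_zero_of_le_or_ge {R : ℝ} (hR : 0 < R)
    {z : EuclideanSpace ℝ (Fin 3)} (hz : ‖z‖ ≤ R ∨ 2 * R ≤ ‖z‖) :
    gradient (cutoffScaled R) z = 0 := by
  rw [gradient]
  rcases hz with hz | hz
  · rw [fderiv_cutoffScaled_eq_zero_of_le hR hz, map_zero]
  · rw [fderiv_cutoffScaled_eq_zero_of_ge hR hz, map_zero]

/-! ### The density `G_R(s, z) = ∇ξ_R(z) · U₀(s, z)` and `w = −G_R ⋆ ∇Γ` -/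

section Density

variable {U₀ : ℝ → EuclideanSpace ℝ (Fin 3) → EuclideanSpace ℝ (Fin 3)} {R : ℝ}

/-- **`w(s,·) = −(G_R(s,·) ⋆ ∇Γ)`**: the divergence correction is minus the gradient-Newtonian
potential of the density `G_R(s,z) = ∇ξ_R(z)·U₀(s,z)`. [cite: BradshawTsai2017AHP, Lemma 2.5 (definition of w)] -/
theorem profileCorrector_eq_neg_convolution (R : ℝ)
    (U₀ : ℝ → EuclideanSpace ℝ (Fin 3) → EuclideanSpace ℝ (Fin 3)) (s : ℝ)
    (y : EuclideanSpace ℝ (Fin 3)) :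
    profileCorrector R U₀ s y =
      -((fun z => ⟪gradient (cutoffScaled R) z, U₀ s z⟫) ⋆[ContinuousLinearMap.lsmul ℝ ℝ,
        volume] gradient newtonKernel) y := by
  rw [convolution_gradient_newtonKernel_apply, profileCorrector]

/-- The density is dominated by `(C_Z/R)|U₀|` on the shell `R < |z| < 2R` and vanishes
elsewhere. [cite: BradshawTsai2017AHP, proof of Lemma 2.5] -/
theorem abs_density_le {C : ℝ} (hC : ∀ {R : ℝ}, 0 < R → ∀ z, ‖gradient (cutoffScaled R) z‖ ≤ C / R)
    (hR : 0 < R) (s : ℝ) (z : EuclideanSpace ℝ (Fin 3)) :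
    |⟪gradient (cutoffScaled R) z, U₀ s z⟫| ≤
      R⁻¹ * ‖C • ({z | R < ‖z‖ ∧ ‖z‖ < 2 * R}.indicator (U₀ s) z)‖ := by
  by_cases hz : z ∈ {z : EuclideanSpace ℝ (Fin 3) | R < ‖z‖ ∧ ‖z‖ < 2 * R}
  · rw [indicator_of_mem hz, norm_smul, Real.norm_eq_abs]
    calc |⟪gradient (cutoffScaled R) z, U₀ s z⟫|
        ≤ ‖gradient (cutoffScaled R) z‖ * ‖U₀ s z‖ := abs_real_inner_le_norm _ _
      _ ≤ C / R * ‖U₀ s z‖ := mul_le_mul_of_nonneg_right (hC hR z) (norm_nonneg _)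
      _ ≤ R⁻¹ * (|C| * ‖U₀ s z‖) := by
          rw [div_eq_inv_mul, mul_assoc]
          exact mul_le_mul_of_nonneg_left (mul_le_mul_of_nonneg_right (le_abs_self C)
            (norm_nonneg _)) (by positivity)
  · have hz' : ‖z‖ ≤ R ∨ 2 * R ≤ ‖z‖ := by
      simp only [mem_setOf_eq, not_and_or, not_lt] at hz
      exact hz
    rw [gradient_cutoffScaled_eq_zero_of_le_or_ge hR hz', inner_zero_left, abs_zero]
    positivity

end Density

/-! ### Regularity, periodicity and solenoidality of `W = ξ_R U₀ + w` -/

section Profile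

variable {U₀ : ℝ → EuclideanSpace ℝ (Fin 3) → EuclideanSpace ℝ (Fin 3)} {R T : ℝ} {q : ℝ≥0∞}

/-- **"`W` is locally continuously differentiable in `y` and `s`"** ([BT1] Lemma 2.5): for
`U₀` jointly `C¹` and `R > 0`, `W = revisedProfile R U₀` is jointly `C¹` (the term `ξ_R U₀` is,
and `w = −G_R ⋆ ∇Γ` is by `NewtonGradPotential.contDiff_convolution_gradient_newtonKernel_param`). [cite: BradshawTsai2017AHP, Lemma 2.5] -/
theorem contDiff_uncurry_revisedProfile (hU : ContDiff ℝ 1 (uncurry U₀)) (hR : 0 < R) :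
    ContDiff ℝ 1 (uncurry (revisedProfile R U₀)) := by
  have e : uncurry (revisedProfile R U₀) = fun p : ℝ × EuclideanSpace ℝ (Fin 3) =>
      cutoffScaled R p.2 • uncurry U₀ p +
        -(((fun z => ⟪gradient (cutoffScaled R) z, U₀ p.1 z⟫) ⋆[ContinuousLinearMap.lsmul ℝ ℝ,
          volume] gradient newtonKernel) p.2) := by
    funext p
    show revisedProfile R U₀ p.1 p.2 = _
    rw [revisedProfile_apply, profileCorrector_eq_neg_convolution]
    rfl
  rw [e]
  refine (((contDiff_cutoffScaled R).comp contDiff_snd).smul hU).add (ContDiff.neg ?_)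
  exact contDiff_convolution_gradient_newtonKernel_param (Φ := fun s z =>
    ⟪gradient (cutoffScaled R) z, U₀ s z⟫) (contDiff_cutoffGradDensity hU R)
    (fun s z hz => cutoffGradDensity_eq_zero hR (U₀ s) hz)

/-- **"`T`-periodic"** ([BT1] Lemma 2.5): `W(s + T) = W(s)` when `U₀(s + T) = U₀(s)`. [cite: BradshawTsai2017AHP, Lemma 2.5] -/
theorem revisedProfile_add_period (hper : ∀ s y, U₀ (s + T) y = U₀ s y) (R s : ℝ)
    (y : EuclideanSpace ℝ (Fin 3)) :
    revisedProfile R U₀ (s + T) y = revisedProfile R U₀ s y := by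
  have e : U₀ (s + T) = U₀ s := funext (hper s)
  rw [revisedProfile_apply, revisedProfile_apply, profileCorrector, profileCorrector, e]

/-- Each slice `U₀(s, ·)` of a jointly `C¹` field is `C¹`. [folklore] -/
theorem contDiff_profileSlice (hU : ContDiff ℝ 1 (uncurry U₀)) (s : ℝ) : ContDiff ℝ 1 (U₀ s) :=
  hU.comp (contDiff_const.prodMk contDiff_id)

/-- Each slice `G_R(s, ·)` of the density is `C¹` with compact support. [cite: BradshawTsai2017AHP, proof of Lemma 2.5] -/
theorem contDiff_density_slice (hU : ContDiff ℝ 1 (uncurry U₀)) (R s : ℝ) :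
    ContDiff ℝ 1 fun z => ⟪gradient (cutoffScaled R) z, U₀ s z⟫ :=
  (contDiff_gradient_cutoffScaled R).inner ℝ (contDiff_profileSlice hU s)

/-- **"divergence free"** ([BT1] Lemma 2.5: "Since `U₀` is divergence free and
`w = ∇(−Δ)⁻¹(∇ξ·U₀)`, we have `div W = ∇ξ·U₀ + div w = 0`"): here
`div(ξ_R U₀) = ξ_R div U₀ + ∇ξ_R·U₀ = G_R` and `div w = −div(G_R ⋆ ∇Γ) = −G_R`
(`NewtonGradPotential.divergence_convolution_gradient_newtonKernel`). [cite: BradshawTsai2017AHP, proof of Lemma 2.5] -/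
theorem isDivFree_revisedProfile (hU : ContDiff ℝ 1 (uncurry U₀))
    (hdiv : ∀ s, VectorCalculus.IsDivFree (U₀ s)) (hR : 0 < R) (s : ℝ) :
    VectorCalculus.IsDivFree (revisedProfile R U₀ s) := by
  intro y
  set G : EuclideanSpace ℝ (Fin 3) → ℝ := fun z => ⟪gradient (cutoffScaled R) z, U₀ s z⟫ with hG
  have hG1 : ContDiff ℝ 1 G := contDiff_density_slice hU R s
  have hGc : HasCompactSupport G := hasCompactSupport_cutoffGradDensity hR (U₀ s)
  have e : revisedProfile R U₀ s = fun y => cutoffScaled R y • U₀ s y -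
      (G ⋆[ContinuousLinearMap.lsmul ℝ ℝ, volume] gradient newtonKernel) y := by
    funext y
    rw [revisedProfile_apply, profileCorrector_eq_neg_convolution, sub_eq_add_neg]
  have hξd : DifferentiableAt ℝ (cutoffScaled R) y :=
    (contDiff_cutoffScaled R (n := 1)).differentiable one_ne_zero y
  have hUd : DifferentiableAt ℝ (U₀ s) y := (contDiff_profileSlice hU s).differentiable one_ne_zero y
  have h1 : DifferentiableAt ℝ (fun y => cutoffScaled R y • U₀ s y) y := hξd.smul hUd
  have h2 : DifferentiableAt ℝ (G ⋆[ContinuousLinearMap.lsmul ℝ ℝ, volume] gradient newtonKernel)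
      y := (contDiff_convolution_gradient_newtonKernel hG1 hGc).differentiable one_ne_zero y
  rw [e, divergence_sub_apply h1 h2, divergence_smul_apply hξd hUd, hdiv s y, mul_zero, zero_add,
    divergence_convolution_gradient_newtonKernel hG1 hGc y, hG, real_inner_comm, sub_self]

end Profile

end BradshawTsai2017

end Literature.Analysis.FluidPDE

end
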